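/-
Origin: expansion seat `planner-pub-hodgecm-mc-glue-1-g11-0`, handover #SG6 2026-08-20T16:55:47Z md5 a68d49693cdc (REPLACE; pre md5 e5a3118c41af → new md5 a68d49693cdc; 103 l.; (μ4) scope-guard rewrite of the RUN-55 installed file; family glue-1; compiled ok 0 proof-hole) (`HOME/mc/pub-hodgecm-mc-glue-1-g11/stage56/HodgeCM/Model/E2InstanceOG.lean`, md5 a68d49693cdc, 103 lines);
landed by the second packager p2 gen 10 (p2-g10) in gate run 56 REPLACES the earlier landed copy of `HodgeCM/Model/E2InstanceOG.lean` (seat copy carried the packager Origin header of an earlier run (stripped)).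
-/
/-
Origin: glue-1 lane, seat `planner-pub-hodgecm-mc-glue-1-g9-0` (unit pub-hodgecm-mc-glue-1-g9), 2026-08-20 — item (TWIST-2), route (c̄)+(o) OF RECORD (lead 1-g60
RULING SUPPLEMENT 2, STATUS 2026-08-20 l.12559; guard cut model1-g10 G3 l.12580 (B)): the CANONICALLY GUARDED oriented E chain — generated from the
oriented chain `HodgeCM/Model/E2InstanceO.lean` (RUN-41 row) by `tools/gen_OG.py`: in the eight class-hypothesis binder groups the guard
`(NumberField.InfinitePlace.mk ι₁).embedding = ι₁ →` follows `Module.finrank ℚ c.K = 6 →`, the guard is threaded pointwise through the proof, and the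
conclusion is `Universe.PerLCanonical` (axioms-3 `Model/PerLOfCanonical`, RUN-41 row #12).  ADDITIVE LEAF; no new definition, record or cite.
-/
import Summits.HodgeConjecture.HodgeCM.Model.EndStateMeetOG
import Summits.HodgeConjecture.HodgeCM.Model.E2Instance

/-!
# E2InstanceOG — guarded oriented E chain

GUARDED VARIANT (item (TWIST-2), route (c̄)+(o) of record): this module is the `O`-module of the same name-stem (RUN-41 kit
`t41-mcglue1g9.txt`) with the canonical-representative guard `(NumberField.InfinitePlace.mk ι₁).embedding = ι₁` inserted after
the class hypothesis `Module.finrank ℚ c.K = 6` of every class-hypothesis binder group and threaded pointwise (`hcan`) through the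
proof; every theorem concludes `Universe.PerLCanonical` instead of `Universe.PerL` (recovered by axioms-3's
`perL_picardCM_of_perLCanonical` in `E2InstanceOGR21AEP`).
-/

noncomputable section

open scoped TensorProduct InnerProductSpace

namespace HodgeCM

namespace Model

open HodgeCM.Universe (AdelicThetaCore AdelicThetaCore₀ SideData ThetaModel ModelAxiomsPerL)
open Literature.AlgebraicGeometry.HodgeTheory
open Literature.NumberTheory.Automorphic.PicardCM

variable (hHD : exists_isReal_hodgeModel) (hI : hodgePQ_independent_of_hodgeModel)
  (h₁ : BallQuotientUniformised)  (h₃ : CMAbelianVarietyRealised)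

/-- **ORIENTED-FAMILY twin of `perL_picardCM`** (`E2Instance`): the recipe bit per complex place, `h ↦ hb L ι₁` in every binder;
proof = the source proof over the oriented predecessor. -/
theorem perLCanonical_picardCMOG (hHR : BettiUniverse.HodgeRiemann20) (hb : ∀ L : CMField, (L →+* ℂ) → Bool)
    (emb : ∀ {L : CMField} {ι₁ : L →+* ℂ} {V : HermSpace3 L ι₁} (Γ : Level V),
      (picardCMUniverse hHD hI h₁ h₃).CohC ((picardCMUniverse hHD hI h₁ h₃).pms L ι₁ V Γ) 2 →ₗ[ℂ]
        (V.latticeModel printFact_unitaryCompact_holds).toQuotientModel.H)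
    (cover : ∀ {L : CMField} {ι₁ : L →+* ℂ} {V : HermSpace3 L ι₁} (Γ Γ' : Level V),
      Γ'.Γ ≤ Γ.Γ → (picardCMUniverse hHD hI h₁ h₃).Mor ((picardCMUniverse hHD hI h₁ h₃).pms L ι₁ V Γ')
        ((picardCMUniverse hHD hI h₁ h₃).pms L ι₁ V Γ))
    (wm : ∀ {L : CMField} {ι₁ : L →+* ℂ} (V : HermSpace3 L ι₁) (c : SeesawCtx L),
      WeilThetaModel (V.latticeModel printFact_unitaryCompact_holds).toQuotientModel.G
        (V.latticeModel printFact_unitaryCompact_holds).toQuotientModel.Γ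
        (c.D.latticeModelW printFact_unitaryCompact_holds).toQuotientModel.G
        (c.D.latticeModelW printFact_unitaryCompact_holds).toQuotientModel.Γ)
    (Theta : ∀ {L : CMField} {ι₁ : L →+* ℂ} (V : HermSpace3 L ι₁), SeesawCtx L → Fin 4 → ∀ Γ : Level V,
      Set ((picardCMUniverse hHD hI h₁ h₃).CohC ((picardCMUniverse hHD hI h₁ h₃).pms L ι₁ V Γ) 1))
    (d12 d34 : ∀ {L : CMField}, SeesawCtx L → SideData L)
    (innerEmb : ∀ {L : CMField} {ι₁ : L →+* ℂ} (V : HermSpace3 L ι₁) (c : SeesawCtx L),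
      (thetaModelOf hHD hI h₁ h₃ (hb L ι₁) emb cover wm Theta d12 d34).GoodCtx ι₁ c → Module.finrank ℚ c.K = 6 ∧ IsNormalClosure ℚ c.K L ∧ (Module.finrank ℚ L = 24 ∨ Module.finrank ℚ L = 48) →
      (NumberField.InfinitePlace.mk ι₁).embedding = ι₁ →
      (thetaModelOf hHD hI h₁ h₃ (hb L ι₁) emb cover wm Theta d12 d34).InnerEmbAt V)
    (thetaSub : ∀ {L : CMField} {ι₁ : L →+* ℂ} (V : HermSpace3 L ι₁) (c : SeesawCtx L),
      (thetaModelOf hHD hI h₁ h₃ (hb L ι₁) emb cover wm Theta d12 d34).GoodCtx ι₁ c → Module.finrank ℚ c.K = 6 ∧ IsNormalClosure ℚ c.K L ∧ (Module.finrank ℚ L = 24 ∨ Module.finrank ℚ L = 48) →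
      (NumberField.InfinitePlace.mk ι₁).embedding = ι₁ →
      ∀ (i : Fin 4) (Γ : Level V), (thetaModelOf hHD hI h₁ h₃ (hb L ι₁) emb cover wm Theta d12 d34).Theta V c i Γ ⊆
        (picardCMUniverse hHD hI h₁ h₃).Uiso Γ c.K (c.Ψ i) c.σ)
    (thetaWedge : ∀ {L : CMField} {ι₁ : L →+* ℂ} (V : HermSpace3 L ι₁) (c : SeesawCtx L),
      (thetaModelOf hHD hI h₁ h₃ (hb L ι₁) emb cover wm Theta d12 d34).GoodCtx ι₁ c → Module.finrank ℚ c.K = 6 ∧ IsNormalClosure ℚ c.K L ∧ (Module.finrank ℚ L = 24 ∨ Module.finrank ℚ L = 48) →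
      (NumberField.InfinitePlace.mk ι₁).embedding = ι₁ →
      ∃ Γ : Level V, ∃ ω₁ ∈ (thetaModelOf hHD hI h₁ h₃ (hb L ι₁) emb cover wm Theta d12 d34).Theta V c 0 Γ,
        ∃ ω₂ ∈ (thetaModelOf hHD hI h₁ h₃ (hb L ι₁) emb cover wm Theta d12 d34).Theta V c 1 Γ,
        (picardCMUniverse hHD hI h₁ h₃).cup2C ((picardCMUniverse hHD hI h₁ h₃).pms L ι₁ V Γ) 1 ω₁ ω₂ ≠ 0)
    (gen12 : ∀ {L : CMField} {ι₁ : L →+* ℂ} (V : HermSpace3 L ι₁) (c : SeesawCtx L),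
      (thetaModelOf hHD hI h₁ h₃ (hb L ι₁) emb cover wm Theta d12 d34).GoodCtx ι₁ c → Module.finrank ℚ c.K = 6 ∧ IsNormalClosure ℚ c.K L ∧ (Module.finrank ℚ L = 24 ∨ Module.finrank ℚ L = 48) →
      (NumberField.InfinitePlace.mk ι₁).embedding = ι₁ →
      Nonempty ((thetaModelOf hHD hI h₁ h₃ (hb L ι₁) emb cover wm Theta d12 d34).Gen12FunBridge V c))
    (real34 : ∀ {L : CMField} {ι₁ : L →+* ℂ} (V : HermSpace3 L ι₁) (c : SeesawCtx L),
      (thetaModelOf hHD hI h₁ h₃ (hb L ι₁) emb cover wm Theta d12 d34).GoodCtx ι₁ c → Module.finrank ℚ c.K = 6 ∧ IsNormalClosure ℚ c.K L ∧ (Module.finrank ℚ L = 24 ∨ Module.finrank ℚ L = 48) →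
      (NumberField.InfinitePlace.mk ι₁).embedding = ι₁ →
      Nonempty ((thetaModelOf hHD hI h₁ h₃ (hb L ι₁) emb cover wm Theta d12 d34).Real34FunBridge V c))
    (occ : ∀ {L : CMField} {ι₁ : L →+* ℂ} (V : HermSpace3 L ι₁) (c : SeesawCtx L),
      (thetaModelOf hHD hI h₁ h₃ (hb L ι₁) emb cover wm Theta d12 d34).GoodCtx ι₁ c → Module.finrank ℚ c.K = 6 ∧ IsNormalClosure ℚ c.K L ∧ (Module.finrank ℚ L = 24 ∨ Module.finrank ℚ L = 48) →
      (NumberField.InfinitePlace.mk ι₁).embedding = ι₁ →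
      (∀ (Φ : (thetaModelOf hHD hI h₁ h₃ (hb L ι₁) emb cover wm Theta d12 d34).SK V c)
          (i : (thetaModelOf hHD hI h₁ h₃ (hb L ι₁) emb cover wm Theta d12 d34).SigIdx V c),
          (∃ v ∈ ((thetaModelOf hHD hI h₁ h₃ (hb L ι₁) emb cover wm Theta d12 d34).core V c).hatσ i,
              ((thetaModelOf hHD hI h₁ h₃ (hb L ι₁) emb cover wm Theta d12 d34).core V c).TΦ Φ v ≠ 0) →
          ((thetaModelOf hHD hI h₁ h₃ (hb L ι₁) emb cover wm Theta d12 d34).t12 V c).wOccurs i) ∧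
        (∀ (Φ : (thetaModelOf hHD hI h₁ h₃ (hb L ι₁) emb cover wm Theta d12 d34).SK V c)
          (i : (thetaModelOf hHD hI h₁ h₃ (hb L ι₁) emb cover wm Theta d12 d34).SigIdx V c),
          (∃ v ∈ ((thetaModelOf hHD hI h₁ h₃ (hb L ι₁) emb cover wm Theta d12 d34).core V c).hatσ i,
              ((thetaModelOf hHD hI h₁ h₃ (hb L ι₁) emb cover wm Theta d12 d34).core V c).TΦ Φ v ≠ 0) →
          ((thetaModelOf hHD hI h₁ h₃ (hb L ι₁) emb cover wm Theta d12 d34).t34 V c).wOccurs i)) :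
    (picardCMUniverse hHD hI h₁ h₃).PerLCanonical :=
  Assembly.perLCanonical_ofFunBridgesOG₁₀ _ (Model.modelAxiomsPerL hHD hI h₃ h₁) hb (coreOf _ emb cover wm Theta) d12 d34
    (S := fun {L} c => Module.finrank ℚ c.K = 6 ∧ IsNormalClosure ℚ c.K L ∧ (Module.finrank ℚ L = 24 ∨ Module.finrank ℚ L = 48))
    (fun _ hK hN h24 => ⟨hK, hN, h24⟩) innerEmb thetaSub thetaWedge gen12 real34 occ
    (Model.hodgeRiemann20 hHD hI h₃ h₁ hHR)

end Model

end HodgeCM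

end
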